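import Summits.ABC.ABC.Theses.IneffectiveSubspace
import Summits.ABC.ABC.Theorems.IneffectiveSubspaceDeepRegimeABCCensusCellEight17Defs
import Literature.NumberTheory.DiophantineGeometry.AbcDepthCensusTurboSym
import Summits.ABC.ABC.Theorems.IneffectiveSubspaceDeepRegimeABCCensusCellEight17A
import Summits.ABC.ABC.Theorems.IneffectiveSubspaceDeepRegimeABCCensusCellEight17B
import Summits.ABC.ABC.Theorems.IneffectiveSubspaceDeepRegimeABCCensusCellEight17C
import Summits.ABC.ABC.Theorems.IneffectiveSubspaceDeepRegimeABCCensusCellEight17D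
import Summits.ABC.ABC.Theorems.IneffectiveSubspaceDeepRegimeABCCensusCellEightD
import Literature.NumberTheory.DiophantineGeometry.AbcDepthCensusWitness

/-!
# `DeepRegimeABC` (stmt-ABC-15121): certified census — the abc triples with `ω₅ ≥ 8` and `c ≤ 10¹⁷` are exactly thirty, none a hit (E, assembly)

Compute-certificate (line lead `prover-line-stmt-ABC-15121-c3-0`, 2026-08-16; human certificate
objective) for the crux `Summit.ABC.ABC.Theses.IneffectiveSubspace.DeepRegimeABC` (abc with exponent
`1 + ε` on the deep tail `{ω₅(abc) ≥ K(ε)}`, `ω₅(n) := #{p : p⁵ ∣ n}`), with the symmetric turbo checker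
`Literature.NumberTheory.DiophantineGeometry.DepthCensus.checkTurboChunkSym` (`AbcDepthCensusTurboSym.lean`:
min-member cut, fused threshold-table walk, run-time-validated CRT unit, patterns with `A ≤ B` only;
`members_complete_of_checkTurboChunksSym`) and the MEMBER test — a candidate passes iff `gcd(a,b) ≠ 1` or
`(a,b,c)` / `(b,a,c)` is one of the thirty listed triples `cellEightMembers17`
(`…CensusCellEight17Defs.lean`, found by the independent C mirror `cert/deep_census.c`).

**The certificate these runs serve** (assembled in `…CensusCellEight17E.lean`, registered stub
`censusCellEight17`): **the abc triples with `ω₅(abc) ≥ 8` and `c ≤ 10¹⁷` are EXACTLY the thirty triples of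
`cellEightMembers17` (up to `a ↔ b`), and none of them is a hit** — the cell `ω₅ ≥ 8` begins
`23115230230115023 (= c₈), 26902725029638843 = 7⁶·11⁵·17⁵, 28575662414467904, …` and holds no abc hit below
`10¹⁷` (largest quality `0.9559…`).  The box has `46 547 712` depth patterns (`7.2·10⁷` tree nodes after
the min-member cut, `6.9·10⁸` outer steps); the cover is the 13-chunk cover `S₁₃` of depth 2
(`coversAll_S8`), spread over five files:

| chunk | patterns | outer steps | file |
|---|---|---|---|
| `[0]` | 2 199 762 | 10 959 795 | A |
| `[1, 0]`, `[2, 0]`, `[3, 0]` | 1 389 322 each | 8 185 519 each | A |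
| `[1, 1]` | 4 432 238 | 70 981 032 | A |
| `[1, 2]`, `[1, 3]` | 4 480 545 each | 73 012 957 each | B |
| `[2, 1]` / `[2, 2]` | 4 480 545 / 4 432 238 | 73 012 957 / 70 981 032 | C |
| `[2, 3]`, `[3, 1]` | 4 480 545 each | 73 012 957 each | D |
| `[3, 2]` / `[3, 3]` | 4 480 545 / 4 432 238 | 73 012 957 / 70 981 032 | E |

(measured: chunk `[1, 2]` 103 s of farm time with the symmetric turbo checker, against ≈ 530 s for the
chunked checker of the earlier census files).

**Certified here** (file E): the last two chunks; the assembly over the cover `S₁₃` (`m8chunks_all`,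
`coversAll_S8` of `…CensusCellEightD.lean`); completeness (`mem_cellEightMembers17_of_le_tenPow17`);
that every listed entry is an abc triple of depth `8` (`cellEightWitness17_ok`, KERNEL `decide` on
`memberWitnessOK`) and not a hit (`cellEightMembers17_noHit`, `noHitOK` by trial-division radicals,
compiled); hence `rad_ge_of_le_tenPow17` (**no abc hit with `ω₅ ≥ 8` below `10¹⁷`**) and
`le_of_eight_le_depth_of_ne_c8` (**the second member of the cell is `26902725029638843 = 7⁶·11⁵·17⁵`**).
The computations trusted to the compiler: the thirteen chunk equations and `cellEightMembers17_noHit`.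
-/

-- `Summit.<Summit>.<Problem>` is the mandated summit-side namespace (CONVENTIONS §2); for the
-- single-conjunct summit `ABC` the two coincide, so the duplicate `ABC.ABC` is deliberate.
set_option linter.dupNamespace false

namespace Summit.ABC.ABC.Theorems.DeepRegimeABC

open Literature.NumberTheory.DiophantineGeometry
open Literature.NumberTheory.DiophantineGeometry.DepthCensus

/-! ## The compiled chunk runs of this file -/

/-- Chunk `[3, 2]` of the cell `ω₅ ≥ 8` in the box `c ≤ 10¹⁷` (4 480 545 patterns, 73 012 957 outer steps): every
coprime candidate is listed in `cellEightMembers17`. [folklore] -/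
theorem m8chunk_32 :
    checkTurboChunkSym (10 ^ 17) 2511 8 [3, 2]
      (fun a b c => !(Nat.gcd a b == 1) || (cellEightMembers17.elem (a, b, c) || cellEightMembers17.elem (b, a, c))) = true := by
  native_decide

/-- Chunk `[3, 3]` of the cell `ω₅ ≥ 8` in the box `c ≤ 10¹⁷` (4 432 238 patterns, 70 981 032 outer steps): every
coprime candidate is listed in `cellEightMembers17`. [folklore] -/
theorem m8chunk_33 :
    checkTurboChunkSym (10 ^ 17) 2511 8 [3, 3]
      (fun a b c => !(Nat.gcd a b == 1) || (cellEightMembers17.elem (a, b, c) || cellEightMembers17.elem (b, a, c))) = true := by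
  native_decide

/-! ## The assembled run over the cover `S₁₃` -/

/-- Every chunk of `S₁₃` accepts the member test (the thirteen runs of files A–E). [folklore] -/
theorem m8chunks_all : ∀ s ∈ ([[0], [1, 0], [1, 1], [1, 2], [1, 3], [2, 0], [2, 1], [2, 2], [2, 3], [3, 0], [3, 1], [3, 2], [3, 3]] : List (List (Fin 4))),
    checkTurboChunkSym (10 ^ 17) 2511 8 s
      (fun a b c => !(Nat.gcd a b == 1) || (cellEightMembers17.elem (a, b, c) || cellEightMembers17.elem (b, a, c))) = true := by
  intro s hs
  simp only [List.mem_cons, List.mem_nil_iff, or_false] at hs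
  rcases hs with rfl | rfl | rfl | rfl | rfl | rfl | rfl | rfl | rfl | rfl | rfl | rfl | rfl
  exacts [m8chunk_0, m8chunk_10, m8chunk_11, m8chunk_12, m8chunk_13, m8chunk_20, m8chunk_21, m8chunk_22, m8chunk_23, m8chunk_30, m8chunk_31, m8chunk_32, m8chunk_33]

/-! ## Completeness: every abc triple of the cell in the box is listed -/

/-- **Every abc triple with `ω₅(abc) ≥ 8` and `c ≤ 10¹⁷` is one of the thirty listed triples** (in one of the
two orientations; `2512⁵ > 10¹⁷`). [folklore] -/
theorem mem_cellEightMembers17_of_le_tenPow17 {a b c : ℕ} (habc : IsABCTriple a b c) (hc : c ≤ 10 ^ 17)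
    (hK : 8 ≤ ((a * b * c).primeFactors.filter (fun p => 5 ≤ (a * b * c).factorization p)).card) :
    (a, b, c) ∈ cellEightMembers17 ∨ (b, a, c) ∈ cellEightMembers17 :=
  members_complete_of_checkTurboChunksSym (by norm_num) coversAll_S8 m8chunks_all habc hc hK

/-! ## Soundness of the list: abc triples of depth 8, no hits -/

/-- Every listed entry is an abc triple with eight distinct deep primes (KERNEL evaluation of
`memberWitnessOK`). [folklore] -/
theorem cellEightWitness17_ok : memberWitnessOK 8 cellEightWitness17 = true := by
  decide

/-- No listed triple is a hit: `c ≤ radL a · radL b · radL c` (trial-division radicals, compiled). [folklore] -/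
theorem cellEightMembers17_noHit : noHitOK cellEightMembers17 = true := by
  native_decide

/-- **Every listed triple is an abc triple of depth `ω₅ ≥ 8`.** [folklore] -/
theorem isABCTriple_of_mem_cellEightMembers17 {t : ℕ × ℕ × ℕ} (ht : t ∈ cellEightMembers17) :
    IsABCTriple t.1 t.2.1 t.2.2 ∧
      8 ≤ ((t.1 * t.2.1 * t.2.2).primeFactors.filter
        (fun p => 5 ≤ (t.1 * t.2.1 * t.2.2).factorization p)).card := by
  rw [← cellEightWitness17_map, List.mem_map] at ht
  obtain ⟨w, hw, rfl⟩ := ht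
  obtain ⟨a, b, c, ps⟩ := w
  exact memberWitnessOK_sound cellEightWitness17_ok hw

/-- **No abc hit with `ω₅(abc) ≥ 8` below `10¹⁷`**: `c ≤ rad(abc)` for every abc triple of the cell in the
box. [folklore] -/
theorem rad_ge_of_le_tenPow17 {a b c : ℕ} (habc : IsABCTriple a b c) (hc : c ≤ 10 ^ 17)
    (hK : 8 ≤ ((a * b * c).primeFactors.filter (fun p => 5 ≤ (a * b * c).factorization p)).card) :
    c ≤ rad a b c :=
  noHitOK_sound cellEightMembers17_noHit habc (mem_cellEightMembers17_of_le_tenPow17 habc hc hK)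

/-- The listed `c` other than `c₈` are at least `26902725029638843`. [folklore] -/
theorem cellEightMembers17_c : ∀ t ∈ cellEightMembers17,
    t.2.2 = 23115230230115023 ∨ 26902725029638843 ≤ t.2.2 := by
  decide

/-- **The second member of the cell `ω₅ ≥ 8` is `26902725029638843 = 7⁶·11⁵·17⁵`**
(`= 5⁵·13⁵·4340411 + 2⁶·3⁵·19⁵·567841`): every abc triple with `ω₅(abc) ≥ 8` other than the two of
`c = c₈ = 23115230230115023` has `c ≥ 26902725029638843`. [folklore] -/
theorem le_of_eight_le_depth_of_ne_c8 {a b c : ℕ} (habc : IsABCTriple a b c)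
    (hK : 8 ≤ ((a * b * c).primeFactors.filter (fun p => 5 ≤ (a * b * c).factorization p)).card)
    (hne : c ≠ 23115230230115023) : 26902725029638843 ≤ c := by
  by_cases hc : c ≤ 10 ^ 17
  · rcases mem_cellEightMembers17_of_le_tenPow17 habc hc hK with hm | hm
    · rcases cellEightMembers17_c _ hm with h | h
      · exact absurd h hne
      · exact h
    · rcases cellEightMembers17_c _ hm with h | h
      · exact absurd h hne
      · exact h
  · omega

/-- The list has thirty entries. [folklore] -/
theorem cellEightMembers17_length : cellEightMembers17.length = 30 := by
  decide

/-! ## Registered certificate stub of the crux item (stmt-ABC-15121) -/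

/-- **Registered certificate `censusCellEight17`** (crux `DeepRegimeABC`, line SketchIdeator5R2, human
certificate objective): the abc triples with `ω₅(abc) ≥ 8` and `c ≤ 10¹⁷` are exactly the thirty triples of
`cellEightMembers17` (up to `a ↔ b`), each an abc triple of depth `8`, none a hit. [folklore] -/
theorem censusCellEight17 : (∀ a b c : ℕ, Literature.NumberTheory.DiophantineGeometry.IsABCTriple a b c → c ≤ 10 ^ 17 → 8 ≤ ((a * b * c).primeFactors.filter (fun p => 5 ≤ (a * b * c).factorization p)).card → (a, b, c) ∈ Summit.ABC.ABC.Theorems.DeepRegimeABC.cellEightMembers17 ∨ (b, a, c) ∈ Summit.ABC.ABC.Theorems.DeepRegimeABC.cellEightMembers17) ∧ (∀ t ∈ Summit.ABC.ABC.Theorems.DeepRegimeABC.cellEightMembers17, Literature.NumberTheory.DiophantineGeometry.IsABCTriple t.1 t.2.1 t.2.2 ∧ 8 ≤ ((t.1 * t.2.1 * t.2.2).primeFactors.filter (fun p => 5 ≤ (t.1 * t.2.1 * t.2.2).factorization p)).card) ∧ (∀ a b c : ℕ, Literature.NumberTheory.DiophantineGeometry.IsABCTriple a b c → c ≤ 10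 ^ 17 → 8 ≤ ((a * b * c).primeFactors.filter (fun p => 5 ≤ (a * b * c).factorization p)).card → c ≤ Literature.NumberTheory.DiophantineGeometry.rad a b c) ∧ Summit.ABC.ABC.Theorems.DeepRegimeABC.cellEightMembers17.length = 30 :=
  ⟨fun _ _ _ h hc hK => mem_cellEightMembers17_of_le_tenPow17 h hc hK,
    fun _ ht => isABCTriple_of_mem_cellEightMembers17 ht,
    fun _ _ _ h hc hK => rad_ge_of_le_tenPow17 h hc hK, cellEightMembers17_length⟩

end Summit.ABC.ABC.Theorems.DeepRegimeABC
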